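import Summits.HodgeConjecture.HodgeCM.Proofs.LandherrRankN_3
import HarnessLib

/-!
# Road b02 (`VHCAbelianSchemesRoad`, D-0059) — stub 2b″ of crux `SemiregularSheafRepresentativesTwAtDiag` (stmt-HodgeConjecture-19787):
# THE HERMITIAN FORM OF EVERY WEIL SIXFOLD COMPONENT IS A SUM OF THREE COPIES OF THE BINARY FORM `⟨1, δ⟩` — the Landherr step of the
# QM-cube description (p535302 / p537129), from the tree's Landherr theorem for diagonal hermitian forms (`HodgeCM.landherr_rank_iff`)

research route conditional on HC_CM; not a corollary; Q11.4-sentence-2 already refuted in dim ≥ 3.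

FACT-FREE (the tree's `HodgeCM.landherr_rank_iff` is a THEOREM of the HodgeCM package: Landherr 1936 for diagonal hermitian forms of any rank over
a CM field, proved there through the norm theorem for quaternion algebras); `HC_CM` nowhere; no `def`. van Geemen 5.4 ([L] = Landherr): the hermitian
form of a polarised abelian `2n`-fold of Weil type `(X, K, E)` is `H ≅ ⟨a, 1, …, 1, −1, …, −1⟩` on a `K`-basis, `a ∈ ℚ_{>0}`, `det H = (−1)ⁿ a`; the
component is SPLIT iff `a ∈ N(K^×)`. THIS FILE, for `n = 3` and over ANY CM field `L` (the route needs `L = K` imaginary quadratic):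
**`⟨a, 1, 1, −1, −1, −1⟩ ≅ ⟨1, −a⟩ ⊥ ⟨1, −a⟩ ⊥ ⟨1, −a⟩`** for every totally positive `σ`-fixed `a ≠ 0` (`weilHermitian_congruent_qmCubeBlocks`: same
positive index `3` at every complex embedding, and `∏ = −a` versus `−a³`, ratio `a⁻² = N(a⁻¹)`) — so EVERY `(3, d, δ)` component, split or not,
contains the diagonal locus of cubes `S³` of the abelian surfaces `S` of Weil type `(1,1)` with form `⟨1, −a⟩ = ⟨1, δ⟩`, i.e. (van Geemen–Verra
Lemma 4.5 read backwards; `SU⟨1,−a⟩ ≅ SL₁((−D, a)_ℚ)`) the surfaces with multiplication by `B_δ = (−D, −δ)_ℚ` — division EXACTLY on the non-split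
components. The parity matters: `det ⟨1,δ⟩^{⊥n} = δⁿ ≡ δ` only for `n` ODD; for fourfolds (`n = 2`) one block must be the hyperbolic plane
(`weilHermitian_congruent_qmSquare_hyperbolic`: `⟨a, 1, −1, −1⟩ ≅ ⟨1, −a⟩ ⊥ ⟨1, −1⟩`, a QM surface times an `E²`-block), which is why the cube trick is a
SIXFOLD phenomenon. Family supply (the components as algebraic families, the curve inside them) remains untyped.
References: [cite: vanGeemen1994HodgeAV, 5.2, 5.4 and 5.7–5.10] [cite: vanGeemenVerra2003QuaternionicPryms, Lemma 4.5] [cite: MoonenZarhin1999LowDim, (1.9) and §2 (2.2)]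
[cite: Deligne1982HodgeCycles, §4 Prop. 4.1 (p. 44)].
-/

noncomputable section

open scoped Matrix

-- the cell's namespace repeats the summit name (`Summit.HodgeConjecture.HodgeConjecture…`), as in every `Ring2*` file
set_option linter.dupNamespace false
namespace Summit.HodgeConjecture.HodgeConjecture.Ring2.SemiregularRepresentatives

open HodgeCM
open Literature.AlgebraicGeometry.ShimuraVarieties (conjRingHomK)

/-- Positive index `3` of `⟨a, 1, 1, −1, −1, −1⟩` at an embedding where `Re τ(a) > 0`. [cite: vanGeemen1994HodgeAV, 5.4] -/
theorem card_pos_weilDiag_six (L : CMField) (τ : L →+* ℂ) {a : L} (hpos : 0 < (τ a).re) :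
    (Finset.univ.filter fun i => 0 < (τ (![a, 1, 1, -1, -1, -1] i)).re).card = 3 := by
  rw [Finset.card_filter, Fin.sum_univ_six]
  simp only [Matrix.cons_val_zero, Matrix.cons_val_one, Matrix.cons_val, map_one, map_neg, Complex.one_re, Complex.neg_re,
    Left.neg_pos_iff, hpos, if_true]
  norm_num

/-- Positive index `3` of `⟨1, −a, 1, −a, 1, −a⟩` at an embedding where `Re τ(a) > 0`. [cite: vanGeemen1994HodgeAV, 5.4] -/
theorem card_pos_qmCubeDiag_six (L : CMField) (τ : L →+* ℂ) {a : L} (hpos : 0 < (τ a).re) :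
    (Finset.univ.filter fun i => 0 < (τ (![1, -a, 1, -a, 1, -a] i)).re).card = 3 := by
  rw [Finset.card_filter, Fin.sum_univ_six]
  have hB : ¬ (τ a).re < 0 := not_lt.2 hpos.le
  simp only [Matrix.cons_val_zero, Matrix.cons_val_one, Matrix.cons_val, map_one, map_neg, Complex.one_re, Complex.neg_re,
    Left.neg_pos_iff, hB, if_false]
  norm_num

/-- **`⟨a, 1, 1, −1, −1, −1⟩ ≅ ⟨1, −a⟩ ⊥ ⟨1, −a⟩ ⊥ ⟨1, −a⟩` OVER EVERY CM FIELD** for `a` `σ`-fixed, non-zero and positive at every complex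
embedding (e.g. `a ∈ ℚ_{>0}`): the hermitian form of a `(3, d, δ)` Weil sixfold component (van Geemen 5.4, `δ = −a`) is `σ`-congruent over `L` to
the diagonal sum of three copies of the binary form `⟨1, δ⟩` of the QM surfaces with multiplication by `(−D, −δ)_ℚ` — by the tree's Landherr theorem
(`HodgeCM.landherr_rank_iff`): both have positive index `3` everywhere and `(−a) = (−a³)·N(a⁻¹)`. [cite: vanGeemen1994HodgeAV, 5.4 and 5.7]
[cite: vanGeemenVerra2003QuaternionicPryms, Lemma 4.5] [cite: Deligne1982HodgeCycles, §4 Prop. 4.1 (p. 44)] -/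
theorem weilHermitian_congruent_qmCubeBlocks (L : CMField) {a : L} (ha : conjRingHomK L a = a) (ha0 : a ≠ 0)
    (hpos : ∀ τ : L →+* ℂ, 0 < (τ a).re) :
    ∃ g : GL (Fin 6) L,
      ((g : Matrix (Fin 6) (Fin 6) L).transpose.map (conjRingHomK L)) * Matrix.diagonal ![a, 1, 1, -1, -1, -1] *
        (g : Matrix (Fin 6) (Fin 6) L) = Matrix.diagonal ![1, -a, 1, -a, 1, -a] := by
  refine (landherr_rank_iff L 6 ![a, 1, 1, -1, -1, -1] ![1, -a, 1, -a, 1, -a] ?_ ?_ ?_ ?_).2 ⟨fun τ ↦ ?_, a⁻¹, inv_ne_zero ha0, ?_⟩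
  · intro i; fin_cases i <;> simp [ha]
  · intro i; fin_cases i <;> simp [ha]
  · intro i; fin_cases i <;> simp [ha0]
  · intro i; fin_cases i <;> simp [ha0]
  · rw [card_pos_weilDiag_six L τ (hpos τ), card_pos_qmCubeDiag_six L τ (hpos τ)]
  · rw [Fin.prod_univ_six, Fin.prod_univ_six]
    simp only [Matrix.cons_val_zero, Matrix.cons_val_one, Matrix.cons_val, map_inv₀, ha]
    field_simp

/-- Positive index `2` of `⟨a, 1, −1, −1⟩` where `Re τ(a) > 0`. [cite: vanGeemen1994HodgeAV, 5.4] -/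
theorem card_pos_weilDiag_four (L : CMField) (τ : L →+* ℂ) {a : L} (hpos : 0 < (τ a).re) :
    (Finset.univ.filter fun i => 0 < (τ (![a, 1, -1, -1] i)).re).card = 2 := by
  rw [Finset.card_filter, Fin.sum_univ_four]
  simp only [Matrix.cons_val_zero, Matrix.cons_val_one, Matrix.cons_val, map_one, map_neg, Complex.one_re, Complex.neg_re,
    Left.neg_pos_iff, hpos, if_true]
  norm_num

/-- Positive index `2` of `⟨1, −a, 1, −1⟩` where `Re τ(a) > 0`. [cite: vanGeemen1994HodgeAV, 5.4] -/
theorem card_pos_qmSquareHypDiag_four (L : CMField) (τ : L →+* ℂ) {a : L} (hpos : 0 < (τ a).re) :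
    (Finset.univ.filter fun i => 0 < (τ (![1, -a, 1, -1] i)).re).card = 2 := by
  rw [Finset.card_filter, Fin.sum_univ_four]
  have hB : ¬ (τ a).re < 0 := not_lt.2 hpos.le
  simp only [Matrix.cons_val_zero, Matrix.cons_val_one, Matrix.cons_val, map_one, map_neg, Complex.one_re, Complex.neg_re,
    Left.neg_pos_iff, hB, if_false]
  norm_num

/-- **The parity remark, fourfold case: `⟨a, 1, −1, −1⟩ ≅ ⟨1, −a⟩ ⊥ ⟨1, −1⟩`** (a QM-surface block and a HYPERBOLIC block — the square
`⟨1,−a⟩ ⊥ ⟨1,−a⟩` has determinant `a² ≡ 1` and is the SPLIT form, so for `n` even one block must be hyperbolic: the «cube trick» of the sixfold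
components has no fourfold analogue). [cite: vanGeemen1994HodgeAV, 5.4] [cite: MoonenZarhin1999LowDim, (1.9)] -/
theorem weilHermitian_congruent_qmSquare_hyperbolic (L : CMField) {a : L} (ha : conjRingHomK L a = a) (ha0 : a ≠ 0)
    (hpos : ∀ τ : L →+* ℂ, 0 < (τ a).re) :
    ∃ g : GL (Fin 4) L,
      ((g : Matrix (Fin 4) (Fin 4) L).transpose.map (conjRingHomK L)) * Matrix.diagonal ![a, 1, -1, -1] *
        (g : Matrix (Fin 4) (Fin 4) L) = Matrix.diagonal ![1, -a, 1, -1] := by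
  refine (landherr_rank_iff L 4 ![a, 1, -1, -1] ![1, -a, 1, -1] ?_ ?_ ?_ ?_).2 ⟨fun τ ↦ ?_, 1, one_ne_zero, ?_⟩
  · intro i; fin_cases i <;> simp [ha]
  · intro i; fin_cases i <;> simp [ha]
  · intro i; fin_cases i <;> simp [ha0]
  · intro i; fin_cases i <;> simp [ha0]
  · rw [card_pos_weilDiag_four L τ (hpos τ), card_pos_qmSquareHypDiag_four L τ (hpos τ)]
  · rw [Fin.prod_univ_four, Fin.prod_univ_four]
    simp only [Matrix.cons_val_zero, Matrix.cons_val_one, Matrix.cons_val, map_one]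
    ring

end Summit.HodgeConjecture.HodgeConjecture.Ring2.SemiregularRepresentatives

end
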